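import Summits.QuantumFields.YangMills.Theorems.GapAtCorrelationLength.Negative.GapAtCorrelationLengthFalseOfLightFluxGroup
import Summits.QuantumFields.YangMills.Theorems.GapAtCorrelationLength.Negative.GapAtCorrelationLengthFalseOfPersistentSlabCorrelation
import Summits.QuantumFields.YangMills.Theorems.MirrorModularBoostsHypercubicLimitClosureHalvesDefs
import Summits.QuantumFields.YangMills.Theorems.MirrorModularBoostsHypercubicLimitPlaneLimitsDefs
import HarnessLib

/-!
# The registered heart H16 (`stub_rpCoreDisjoint` of cruxes stmt-8646 / stmt-16154 / stmt-16120) — negative lemmas modulo light flux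

Negative lemmas (line lead c16 of crux stmt-QuantumFields-8646 `MirrorModularBoosts.HypercubicLimit`).  Tree objects only; the
statement refuted is the REGISTERED STUB H16 — the "disjoint RP core", character-identical in the registered skeletons of
stmt-QuantumFields-8646 (line `conditional-mean-telescoping`, reshape 6), stmt-QuantumFields-16154 (line `peel-and-disseminate`,
reshape 5) and stmt-QuantumFields-16120 (line `Sketch`), and the hypothesis of the landed `hypercubicLimit_of_rpCoreDisjoint`
(p149207) / `hypercubicLimit_of_rpCoreDisjoint_8646` (p167242) — NOT the crux `HypercubicLimit` itself (which has no RP-spectral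
clause and is not claimed false).

**Finding.**  H16 asks, for SOME Wilson scheme at weak coupling, the RP-spectral clustering clause
`CouplingResponse.RPSpectral r sch Δ C` over the spatially GLOBAL time-slab class: bounded measurable `Y` depending on the edges of
the time slab `[1, T]`, NO spatial restriction, `Y` chosen after the torus side `2S+1 ≥ 2L_k+1`, with the exponentially small
thermal error `C B² e^{−Δ a_k S}`.  This is character for character the clause for which W₁ =
`ScalingWindowSplit.GapAtCorrelationLength` (stmt-18927) is refuted modulo a light-flux hypothesis
(`gapAtCorrelationLength_false_of_lightFluxMode`, `GapAtCorrelationLength_false_of_PersistentSlabCorrelation`, landed), and that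
bookkeeping uses ONLY weak coupling, `0 < Δ` and the global clause — all three present in H16.  Hence:

* `rpSpectral_false_of_lightFlux_at` — the core, per `(G, r, sch, Δ, C)`: weak coupling + `0 < Δ` + `RPSpectral r sch Δ C` +
  a light-flux mode of `r` (eventually in `β`) ⇒ `False`;
* `irInputs_false_of_lightFlux_at` — the same for the bundled IR hypothesis `CouplingResponse.IRInputs r sch` of line `Sketch`
  (16120 / 16154), whose clause (b) is `RPSpectral` (`irInputs_iff`);
* `rpCoreDisjoint_false_of_lightFluxMode` — an admissible `G` with `LightFluxMode G` refutes H16;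
  `rpCoreDisjoint_false_of_LightFluxGroup : LightFluxGroup → ¬ H16`; `rpCoreDisjoint_false_of_lightFluxMode_SO3`;
* `lightFluxMode_of_persistent` and `rpCoreDisjoint_false_of_PersistentSlabCorrelation : PersistentSlabCorrelation → ¬ H16`
  (the weakest landed `H`).

**Why `H` is expected** (physics; see the docstrings of the two imported W₁ files): for the admissible centre-free group
`G = SO(3)` (`isCompactSimpleLieGroup_SO3`) the disc-repaired `ℤ₂` magnetic flux through a spatial 2-torus is a bounded slab
functional whose reflected covariance stays `≥ e^{−o(S)}` at weak coupling ('t Hooft's light flux; de Forcrand–Jahn); rigorously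
open, hence `H` stays a hypothesis.

**Consequence for the three registries (class, on paper: stub-MISSTATED — over-quantified functional class).**  Repair `C′`:
quantify the clause over the LOCAL slab class (`∀ i ≠ 0, |e.1 i| ≤ R`, `2(R+1) ≤ S₀`) — the hypothesis of the landed local seam
`ContinuumFromLatticeGap.oneField_of_latticeInequalities_local` — i.e. replace H16 by the r1 strategist's REPAIRED lattice triple
W₁ᴸ / U_RS / W₂ᴳ (`Cruxes/HypercubicLimit/SPLIT-r1.md`; glue landed for 8646 as
`Theorems/MirrorModularBoostsHypercubicLimitOfRepairedTriple.lean`); the flux witness misses `C′` (a box with `2(R+1) ≤ S₀` wraps no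
2-cycle of the torus).  The registered skeleton of stmt-8646 is reshaped accordingly (reshape 7, c16).  No `sorry`; axioms `propext`,
`Classical.choice`, `Quot.sound`.
-/

noncomputable section

open scoped SchwartzMap BigOperators Topology
open MeasureTheory Filter Set Function
open Literature.MathematicalPhysics.QuantumLattice Literature.MathematicalPhysics.AQFT
open Literature.MathematicalPhysics.QuantumFieldTheory
open Summit.QuantumFields.YangMills.Cruxes.HypercubicLimit.CouplingResponse
  (PolyVolume UniformFunctionalBoundPlanes RPSpectral IRInputs irInputs_iff)
open Summit.QuantumFields.YangMills.Theorems.GapAtCorrelationLength.Negative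
  (LightFluxMode LightFluxGroup PersistentSlabCorrelation lightFluxGroup_of_SO3)
open Literature.AlgebraicTopology.FundamentalGroup (SO3)
open Summit.QuantumFields.YangMills.Theorems.NonSimplyConnectedLatticeGap
  (so3_isTopologicalGroup so3_compactSpace isCompactSimpleLieGroup_SO3)

namespace Summit.QuantumFields.YangMills.Theorems.HypercubicLimit.Negative

section Core

variable {G : Type} [Group G] [TopologicalSpace G] [IsTopologicalGroup G] [CompactSpace G]
  [MeasurableSpace G] [BorelSpace G]

/-- **Core bookkeeping (per scheme).**  Along a scheme at weak coupling, the GLOBAL-class RP-spectral clause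
`RPSpectral r sch Δ C` with `0 < Δ` is incompatible with a light-flux mode of `r`: eventually in `β`, for every rate `ε > 0`
and beyond every size, a bounded slab functional with reflected time-`n` covariance `≥ e^{−εS}` at a separation `n ≥ S/4`.
At a step `k` where the clause is active and `β_k` is in the light-flux regime take `ε := Δ a_k / 8` and the witness on a torus
`S ≥ L_k`: the clause gives covariance `≤ e^{−Δ a_k n}·1 + C e^{−Δ a_k S} ≤ e^{−εS}(e^{−Δ a_k S/8} + |C| e^{−7Δ a_k S/8}) < e^{−εS}`.
-- adapted from Theorems/GapAtCorrelationLength/Negative/GapAtCorrelationLengthFalseOfLightFluxGroup.lean [folklore] -/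
theorem rpSpectral_false_of_lightFlux_at (r : LatticeRep G) (sch : SpeciesScheme (YMSpecies G)) (Δ C : ℝ)
    (hweak : sch.HasWeakCouplingLimit) (hΔ : 0 < Δ) (hRP : RPSpectral r sch Δ C)
    (hH : ∀ᶠ β : ℝ in atTop, ∀ ε : ℝ, 0 < ε → ∀ M₀ : ℕ,
      ∃ (S T n : ℕ), M₀ ≤ S ∧ 2 * (T + n + 1) ≤ S ∧ S ≤ 4 * n ∧
      ∃ (Y : LGConfig 4 G → ℝ), Measurable Y ∧ (∀ U, |Y U| ≤ 1) ∧
        DependsOn Y {e : Literature.MathematicalPhysics.QuantumLattice.ZdEdge 4 |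
          1 ≤ e.1 0 ∧ e.1 0 + (if e.2 = 0 then 1 else 0) ≤ T} ∧
        Real.exp (-(ε * S)) ≤
          (∫ U, Y (torusLift (2 * S + 1) (GaugeConfig.timeReflect U)) *
              Y (configShift (-Pi.single 0 (n : ℤ)) (torusLift (2 * S + 1) U))
              ∂(wilsonMeasure r.ρ β : Measure (GaugeConfig 4 (2 * S + 1) G))) -
          (∫ U, Y (torusLift (2 * S + 1) U)
              ∂(wilsonMeasure r.ρ β : Measure (GaugeConfig 4 (2 * S + 1) G))) ^ 2) :
    False := by
  -- a step `k` at which the RP-spectral clause is active and the coupling is in the light-flux regime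
  obtain ⟨k, hRPk, hβk⟩ := (hRP.and (hweak.eventually hH)).exists
  have ha : 0 < sch.a k := sch.a_pos k
  have hΔa : 0 < Δ * sch.a k := mul_pos hΔ ha
  -- the rate of the witness: ε := Δ a_k / 8
  set ε : ℝ := Δ * sch.a k / 8 with hε_def
  have hε : 0 < ε := by positivity
  -- h(S) := e^{-Δ a S/8} + |C| e^{-7 Δ a S/8} → 0
  set h : ℝ → ℝ := fun x =>
      Real.exp (-(Δ * sch.a k * x / 8)) + |C| * Real.exp (-(7 * (Δ * sch.a k) * x / 8)) with hh_def
  have hh : Tendsto h atTop (𝓝 0) := by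
    have h1 : Tendsto (fun x : ℝ => Δ * sch.a k * x / 8) atTop atTop :=
      (tendsto_id.const_mul_atTop hΔa).atTop_div_const (by norm_num)
    have h7 : Tendsto (fun x : ℝ => 7 * (Δ * sch.a k) * x / 8) atTop atTop :=
      (tendsto_id.const_mul_atTop (by positivity : (0:ℝ) < 7 * (Δ * sch.a k))).atTop_div_const
        (by norm_num)
    have e1 : Tendsto (fun x : ℝ => Real.exp (-(Δ * sch.a k * x / 8))) atTop (𝓝 0) :=
      Real.tendsto_exp_atBot.comp (tendsto_neg_atTop_atBot.comp h1)
    have e2 : Tendsto (fun x : ℝ => |C| * Real.exp (-(7 * (Δ * sch.a k) * x / 8))) atTop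
        (𝓝 (|C| * 0)) :=
      (Real.tendsto_exp_atBot.comp (tendsto_neg_atTop_atBot.comp h7)).const_mul |C|
    simpa [hh_def] using e1.add e2
  have hhN : Tendsto (fun S : ℕ => h S) atTop (𝓝 0) := hh.comp tendsto_natCast_atTop_atTop
  obtain ⟨N₀, hN₀⟩ := eventually_atTop.1 (hhN.eventually (gt_mem_nhds (by norm_num : (0:ℝ) < 1)))
  -- the witness on a torus beyond `max N₀ L_k`
  obtain ⟨S, T, n, hMS, h2, h4, Y, hYm, hYb, hYdep, hcov⟩ := hβk ε hε (max N₀ (sch.L k))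
  have hLS : sch.L k ≤ S := (le_max_right _ _).trans hMS
  have hNS : N₀ ≤ S := (le_max_left _ _).trans hMS
  have key := hRPk S T n hLS h2 Y 1 hYm hYb hYdep
  -- `⟨ΘY · Y⟩ ≤ 1`: `|Y| ≤ 1` under a probability measure
  haveI : IsProbabilityMeasure (wilsonMeasure (d := 4) (L := 2 * S + 1) (G := G) r.ρ (sch.β k)) :=
    isProbabilityMeasure_wilsonMeasure r.ρ r.continuous _
  have hI0 : (∫ U, Y (torusLift (2 * S + 1) (GaugeConfig.timeReflect U)) * Y (torusLift (2 * S + 1) U)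
      ∂(wilsonMeasure r.ρ (sch.β k) : Measure (GaugeConfig 4 (2 * S + 1) G))) ≤ 1 := by
    have hb : ∀ U : GaugeConfig 4 (2 * S + 1) G,
        ‖Y (torusLift (2 * S + 1) (GaugeConfig.timeReflect U)) * Y (torusLift (2 * S + 1) U)‖ ≤ 1 := by
      intro U
      rw [Real.norm_eq_abs, abs_mul]
      have h1 := hYb (torusLift (2 * S + 1) (GaugeConfig.timeReflect U))
      have h2 := hYb (torusLift (2 * S + 1) U)
      have h3 := abs_nonneg (Y (torusLift (2 * S + 1) (GaugeConfig.timeReflect U)))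
      nlinarith
    have hint := norm_integral_le_of_norm_le_const
      (μ := (wilsonMeasure r.ρ (sch.β k) : Measure (GaugeConfig 4 (2 * S + 1) G)))
      (Eventually.of_forall hb)
    simp only [probReal_univ, mul_one, Real.norm_eq_abs] at hint
    exact (le_abs_self _).trans hint
  generalize hIn_def : (∫ U, Y (torusLift (2 * S + 1) (GaugeConfig.timeReflect U)) *
      Y (configShift (-Pi.single 0 (n : ℤ)) (torusLift (2 * S + 1) U))
      ∂(wilsonMeasure r.ρ (sch.β k) : Measure (GaugeConfig 4 (2 * S + 1) G))) = In at key hcov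
  generalize hI0_def : (∫ U, Y (torusLift (2 * S + 1) (GaugeConfig.timeReflect U)) *
      Y (torusLift (2 * S + 1) U)
      ∂(wilsonMeasure r.ρ (sch.β k) : Measure (GaugeConfig 4 (2 * S + 1) G))) = I0 at key hI0
  generalize hm_def : (∫ U, Y (torusLift (2 * S + 1) U)
      ∂(wilsonMeasure r.ρ (sch.β k) : Measure (GaugeConfig 4 (2 * S + 1) G))) = m at key hcov
  -- exponent algebra: e^{-Δ a n} ≤ e^{-Δ a S/4} = e^{-εS} e^{-Δ a S/8},  e^{-Δ a S} = e^{-εS} e^{-7Δ a S/8}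
  have hS4 : (S : ℝ) ≤ 4 * n := by exact_mod_cast h4
  have hexp_n : Real.exp (-(Δ * sch.a k * n)) ≤ Real.exp (-(Δ * sch.a k * S / 4)) := by
    apply Real.exp_le_exp.2
    nlinarith [mul_le_mul_of_nonneg_left hS4 hΔa.le]
  have hsplit4 : Real.exp (-(Δ * sch.a k * S / 4)) =
      Real.exp (-(ε * S)) * Real.exp (-(Δ * sch.a k * S / 8)) := by
    rw [← Real.exp_add, hε_def]; ring_nf
  have hsplit1 : Real.exp (-(Δ * sch.a k * S)) =
      Real.exp (-(ε * S)) * Real.exp (-(7 * (Δ * sch.a k) * S / 8)) := by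
    rw [← Real.exp_add, hε_def]; ring_nf
  have hE : 0 < Real.exp (-(ε * S)) := Real.exp_pos _
  have hexp0 : 0 ≤ Real.exp (-(Δ * sch.a k * n)) := Real.exp_nonneg _
  have hdiff : I0 - m ^ 2 ≤ 1 := by nlinarith [sq_nonneg m]
  -- upper bound from the clause
  have hup : In - m ^ 2 ≤ Real.exp (-(ε * S)) * h S := by
    have t1 : Real.exp (-(Δ * sch.a k * n)) * (I0 - m ^ 2) ≤
        Real.exp (-(ε * S)) * Real.exp (-(Δ * sch.a k * S / 8)) := by
      calc Real.exp (-(Δ * sch.a k * n)) * (I0 - m ^ 2)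
          ≤ Real.exp (-(Δ * sch.a k * n)) * 1 := mul_le_mul_of_nonneg_left hdiff hexp0
        _ ≤ Real.exp (-(Δ * sch.a k * S / 4)) := by simpa using hexp_n
        _ = _ := hsplit4
    have t2 : C * (1 : ℝ) ^ 2 * Real.exp (-(Δ * sch.a k * S)) ≤
        Real.exp (-(ε * S)) * (|C| * Real.exp (-(7 * (Δ * sch.a k) * S / 8))) := by
      rw [hsplit1]
      have hC := le_abs_self C
      have hE7 : 0 ≤ Real.exp (-(7 * (Δ * sch.a k) * S / 8)) := Real.exp_nonneg _
      nlinarith [mul_nonneg hE.le hE7]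
    have hlhs : In - m ^ 2 ≤ |In - m ^ 2| := le_abs_self _
    have : In - m ^ 2 ≤ Real.exp (-(ε * S)) * Real.exp (-(Δ * sch.a k * S / 8)) +
        Real.exp (-(ε * S)) * (|C| * Real.exp (-(7 * (Δ * sch.a k) * S / 8))) := by linarith
    simpa [hh_def, mul_add] using this
  -- lower bound from the witness and the contradiction `e^{-εS} ≤ In - m² ≤ e^{-εS} h S < e^{-εS}`
  have hhS : h S < 1 := hN₀ S hNS
  have : Real.exp (-(ε * S)) * h S < Real.exp (-(ε * S)) * 1 := mul_lt_mul_of_pos_left hhS hE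
  linarith

/-- **The bundled IR hypothesis of line `Sketch` dies the same way (per scheme).**  `CouplingResponse.IRInputs r sch` (clause (b)
is `RPSpectral`, `irInputs_iff`) at weak coupling is incompatible with a light-flux mode of `r`. [folklore] -/
theorem irInputs_false_of_lightFlux_at (r : LatticeRep G) (sch : SpeciesScheme (YMSpecies G))
    (hweak : sch.HasWeakCouplingLimit) (hIR : IRInputs r sch)
    (hH : ∀ᶠ β : ℝ in atTop, ∀ ε : ℝ, 0 < ε → ∀ M₀ : ℕ,
      ∃ (S T n : ℕ), M₀ ≤ S ∧ 2 * (T + n + 1) ≤ S ∧ S ≤ 4 * n ∧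
      ∃ (Y : LGConfig 4 G → ℝ), Measurable Y ∧ (∀ U, |Y U| ≤ 1) ∧
        DependsOn Y {e : Literature.MathematicalPhysics.QuantumLattice.ZdEdge 4 |
          1 ≤ e.1 0 ∧ e.1 0 + (if e.2 = 0 then 1 else 0) ≤ T} ∧
        Real.exp (-(ε * S)) ≤
          (∫ U, Y (torusLift (2 * S + 1) (GaugeConfig.timeReflect U)) *
              Y (configShift (-Pi.single 0 (n : ℤ)) (torusLift (2 * S + 1) U))
              ∂(wilsonMeasure r.ρ β : Measure (GaugeConfig 4 (2 * S + 1) G))) -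
          (∫ U, Y (torusLift (2 * S + 1) U)
              ∂(wilsonMeasure r.ρ β : Measure (GaugeConfig 4 (2 * S + 1) G))) ^ 2) :
    False := by
  obtain ⟨⟨Δ, C, hΔ, -, hRP⟩, -, -⟩ := (irInputs_iff r sch).1 hIR
  exact rpSpectral_false_of_lightFlux_at r sch Δ C hweak hΔ hRP hH

end Core

/-- **An admissible gauge group with a light-flux mode refutes the registered heart H16** (`stub_rpCoreDisjoint` of stmt-8646 /
stmt-16154 / stmt-16120, verbatim; the hypothesis of `hypercubicLimit_of_rpCoreDisjoint_8646`, p167242).  H16 at that `G`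
supplies a scheme at weak coupling with the global RP-spectral clause at some `Δ > 0`; `rpSpectral_false_of_lightFlux_at`.
[folklore] -/
theorem rpCoreDisjoint_false_of_lightFluxMode
    (G : Type) [Group G] [TopologicalSpace G] [IsTopologicalGroup G] [CompactSpace G]
    (hG : IsCompactSimpleLieGroup G) (hH : LightFluxMode G) :
    ¬ (∀ (G : Type) [Group G] [TopologicalSpace G] [IsTopologicalGroup G] [CompactSpace G]
      [MeasurableSpace G] [BorelSpace G], IsCompactSimpleLieGroup G →
      ∃ (r : LatticeRep G) (sch : SpeciesScheme (YMSpecies G)),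
        sch.HasWeakCouplingLimit ∧ PolyVolume sch ∧
          Summit.QuantumFields.YangMills.Cruxes.HypercubicLimit.CouplingResponse.PolyRenorm r sch ∧
          UniformFunctionalBoundPlanes r sch ∧
        (∃ Δ C : ℝ, 0 < Δ ∧ RPSpectral r sch Δ C) ∧
        (∃ (f g h : 𝓢(EuclideanSpace ℝ (Fin 4), ℝ)) (δ : ℝ),
          Disjoint (tsupport f) (tsupport g) ∧ Disjoint (tsupport f) (tsupport h) ∧
          Disjoint (tsupport g) (tsupport h) ∧ 0 < δ ∧
          ∀ᶠ k in atTop, δ ≤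
            |latticeSchwinger r.ρ sch (fun s => s.F) k 3 (fun _ => r.curvature) ![f, g, h] -
              latticeSchwinger r.ρ sch (fun s => s.F) k 1 (fun _ => r.curvature) ![f] *
                latticeSchwinger r.ρ sch (fun s => s.F) k 2 (fun _ => r.curvature) ![g, h] -
              latticeSchwinger r.ρ sch (fun s => s.F) k 1 (fun _ => r.curvature) ![g] *
                latticeSchwinger r.ρ sch (fun s => s.F) k 2 (fun _ => r.curvature) ![f, h] -
              latticeSchwinger r.ρ sch (fun s => s.F) k 1 (fun _ => r.curvature) ![h] *
                latticeSchwinger r.ρ sch (fun s => s.F) k 2 (fun _ => r.curvature) ![f, g] +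
              2 * (latticeSchwinger r.ρ sch (fun s => s.F) k 1 (fun _ => r.curvature) ![f] *
                latticeSchwinger r.ρ sch (fun s => s.F) k 1 (fun _ => r.curvature) ![g] *
                latticeSchwinger r.ρ sch (fun s => s.F) k 1 (fun _ => r.curvature) ![h])|)) := by
  intro hcore
  letI : MeasurableSpace G := borel G
  haveI : BorelSpace G := ⟨rfl⟩
  obtain ⟨r, sch, hweak, -, -, -, ⟨Δ, C, hΔ, hRP⟩, -⟩ := hcore G hG
  exact rpSpectral_false_of_lightFlux_at r sch Δ C hweak hΔ hRP (hH r)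

/-- **Negative lemma modulo `H = LightFluxGroup`: a light-flux group refutes the registered heart H16.**  Class (on paper):
stub-misstated — the RP-spectral clause of H16 quantifies over spatially GLOBAL slab functionals; the repair re-quantifies it over
the LOCAL slab class (the r1 strategist's repaired triple W₁ᴸ / U_RS / W₂ᴳ), which the flux witness behind `H` does not meet.
[folklore] -/
theorem rpCoreDisjoint_false_of_LightFluxGroup (hH : LightFluxGroup) :
    ¬ (∀ (G : Type) [Group G] [TopologicalSpace G] [IsTopologicalGroup G] [CompactSpace G]
      [MeasurableSpace G] [BorelSpace G], IsCompactSimpleLieGroup G →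
      ∃ (r : LatticeRep G) (sch : SpeciesScheme (YMSpecies G)),
        sch.HasWeakCouplingLimit ∧ PolyVolume sch ∧
          Summit.QuantumFields.YangMills.Cruxes.HypercubicLimit.CouplingResponse.PolyRenorm r sch ∧
          UniformFunctionalBoundPlanes r sch ∧
        (∃ Δ C : ℝ, 0 < Δ ∧ RPSpectral r sch Δ C) ∧
        (∃ (f g h : 𝓢(EuclideanSpace ℝ (Fin 4), ℝ)) (δ : ℝ),
          Disjoint (tsupport f) (tsupport g) ∧ Disjoint (tsupport f) (tsupport h) ∧
          Disjoint (tsupport g) (tsupport h) ∧ 0 < δ ∧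
          ∀ᶠ k in atTop, δ ≤
            |latticeSchwinger r.ρ sch (fun s => s.F) k 3 (fun _ => r.curvature) ![f, g, h] -
              latticeSchwinger r.ρ sch (fun s => s.F) k 1 (fun _ => r.curvature) ![f] *
                latticeSchwinger r.ρ sch (fun s => s.F) k 2 (fun _ => r.curvature) ![g, h] -
              latticeSchwinger r.ρ sch (fun s => s.F) k 1 (fun _ => r.curvature) ![g] *
                latticeSchwinger r.ρ sch (fun s => s.F) k 2 (fun _ => r.curvature) ![f, h] -
              latticeSchwinger r.ρ sch (fun s => s.F) k 1 (fun _ => r.curvature) ![h] *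
                latticeSchwinger r.ρ sch (fun s => s.F) k 2 (fun _ => r.curvature) ![f, g] +
              2 * (latticeSchwinger r.ρ sch (fun s => s.F) k 1 (fun _ => r.curvature) ![f] *
                latticeSchwinger r.ρ sch (fun s => s.F) k 1 (fun _ => r.curvature) ![g] *
                latticeSchwinger r.ρ sch (fun s => s.F) k 1 (fun _ => r.curvature) ![h])|)) := by
  obtain ⟨G, _, _, _, _, hG, hHG⟩ := hH
  exact rpCoreDisjoint_false_of_lightFluxMode G hG hHG

/-- **`SO(3)` specialisation**: a light-flux mode of `SO(3)` alone refutes H16 (`SO(3)` is admissible: `isCompactSimpleLieGroup_SO3`).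
[folklore] -/
theorem rpCoreDisjoint_false_of_lightFluxMode_SO3
    (hH : @LightFluxMode SO3 _ _ so3_isTopologicalGroup so3_compactSpace) :
    ¬ (∀ (G : Type) [Group G] [TopologicalSpace G] [IsTopologicalGroup G] [CompactSpace G]
      [MeasurableSpace G] [BorelSpace G], IsCompactSimpleLieGroup G →
      ∃ (r : LatticeRep G) (sch : SpeciesScheme (YMSpecies G)),
        sch.HasWeakCouplingLimit ∧ PolyVolume sch ∧
          Summit.QuantumFields.YangMills.Cruxes.HypercubicLimit.CouplingResponse.PolyRenorm r sch ∧
          UniformFunctionalBoundPlanes r sch ∧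
        (∃ Δ C : ℝ, 0 < Δ ∧ RPSpectral r sch Δ C) ∧
        (∃ (f g h : 𝓢(EuclideanSpace ℝ (Fin 4), ℝ)) (δ : ℝ),
          Disjoint (tsupport f) (tsupport g) ∧ Disjoint (tsupport f) (tsupport h) ∧
          Disjoint (tsupport g) (tsupport h) ∧ 0 < δ ∧
          ∀ᶠ k in atTop, δ ≤
            |latticeSchwinger r.ρ sch (fun s => s.F) k 3 (fun _ => r.curvature) ![f, g, h] -
              latticeSchwinger r.ρ sch (fun s => s.F) k 1 (fun _ => r.curvature) ![f] *
                latticeSchwinger r.ρ sch (fun s => s.F) k 2 (fun _ => r.curvature) ![g, h] -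
              latticeSchwinger r.ρ sch (fun s => s.F) k 1 (fun _ => r.curvature) ![g] *
                latticeSchwinger r.ρ sch (fun s => s.F) k 2 (fun _ => r.curvature) ![f, h] -
              latticeSchwinger r.ρ sch (fun s => s.F) k 1 (fun _ => r.curvature) ![h] *
                latticeSchwinger r.ρ sch (fun s => s.F) k 2 (fun _ => r.curvature) ![f, g] +
              2 * (latticeSchwinger r.ρ sch (fun s => s.F) k 1 (fun _ => r.curvature) ![f] *
                latticeSchwinger r.ρ sch (fun s => s.F) k 1 (fun _ => r.curvature) ![g] *
                latticeSchwinger r.ρ sch (fun s => s.F) k 1 (fun _ => r.curvature) ![h])|)) :=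
  rpCoreDisjoint_false_of_LightFluxGroup (lightFluxGroup_of_SO3 hH)

/-- **Persistent slab correlation is a light-flux mode** (the `∃ β₀ ∀ β ≥ β₀` form implies the `∀ᶠ β` form; inner bodies identical),
so the weakest landed hypothesis `PersistentSlabCorrelation` also feeds the core lemma. [folklore] -/
theorem lightFluxMode_of_persistent
    (G : Type) [Group G] [TopologicalSpace G] [IsTopologicalGroup G] [CompactSpace G]
    (hH : letI : MeasurableSpace G := borel G
      haveI : BorelSpace G := ⟨rfl⟩
      ∀ (r : LatticeRep G), ∃ β₀ : ℝ, ∀ β : ℝ, β₀ ≤ β → ∀ μ : ℝ, 0 < μ → ∀ M₀ : ℕ,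
      ∃ (S T n : ℕ), M₀ ≤ S ∧ 2 * (T + n + 1) ≤ S ∧ S ≤ 4 * n ∧
      ∃ (Y : LGConfig 4 G → ℝ), Measurable Y ∧ (∀ U, |Y U| ≤ 1) ∧
        DependsOn Y {e : Literature.MathematicalPhysics.QuantumLattice.ZdEdge 4 |
          1 ≤ e.1 0 ∧ e.1 0 + (if e.2 = 0 then 1 else 0) ≤ T} ∧
        Real.exp (-(μ * S)) ≤
          (∫ U, Y (torusLift (2 * S + 1) (GaugeConfig.timeReflect U)) *
              Y (configShift (-Pi.single 0 (n : ℤ)) (torusLift (2 * S + 1) U))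
              ∂(wilsonMeasure r.ρ β : Measure (GaugeConfig 4 (2 * S + 1) G))) -
          (∫ U, Y (torusLift (2 * S + 1) U)
              ∂(wilsonMeasure r.ρ β : Measure (GaugeConfig 4 (2 * S + 1) G))) ^ 2) :
    LightFluxMode G := by
  intro r
  obtain ⟨β₀, hβ₀⟩ := hH r
  exact eventually_atTop.2 ⟨β₀, hβ₀⟩

/-- **Negative lemma modulo the weakest landed `H`: `PersistentSlabCorrelation → ¬ H16`.** [folklore] -/
theorem rpCoreDisjoint_false_of_PersistentSlabCorrelation (hH : PersistentSlabCorrelation) :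
    ¬ (∀ (G : Type) [Group G] [TopologicalSpace G] [IsTopologicalGroup G] [CompactSpace G]
      [MeasurableSpace G] [BorelSpace G], IsCompactSimpleLieGroup G →
      ∃ (r : LatticeRep G) (sch : SpeciesScheme (YMSpecies G)),
        sch.HasWeakCouplingLimit ∧ PolyVolume sch ∧
          Summit.QuantumFields.YangMills.Cruxes.HypercubicLimit.CouplingResponse.PolyRenorm r sch ∧
          UniformFunctionalBoundPlanes r sch ∧
        (∃ Δ C : ℝ, 0 < Δ ∧ RPSpectral r sch Δ C) ∧
        (∃ (f g h : 𝓢(EuclideanSpace ℝ (Fin 4), ℝ)) (δ : ℝ),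
          Disjoint (tsupport f) (tsupport g) ∧ Disjoint (tsupport f) (tsupport h) ∧
          Disjoint (tsupport g) (tsupport h) ∧ 0 < δ ∧
          ∀ᶠ k in atTop, δ ≤
            |latticeSchwinger r.ρ sch (fun s => s.F) k 3 (fun _ => r.curvature) ![f, g, h] -
              latticeSchwinger r.ρ sch (fun s => s.F) k 1 (fun _ => r.curvature) ![f] *
                latticeSchwinger r.ρ sch (fun s => s.F) k 2 (fun _ => r.curvature) ![g, h] -
              latticeSchwinger r.ρ sch (fun s => s.F) k 1 (fun _ => r.curvature) ![g] *
                latticeSchwinger r.ρ sch (fun s => s.F) k 2 (fun _ => r.curvature) ![f, h] -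
              latticeSchwinger r.ρ sch (fun s => s.F) k 1 (fun _ => r.curvature) ![h] *
                latticeSchwinger r.ρ sch (fun s => s.F) k 2 (fun _ => r.curvature) ![f, g] +
              2 * (latticeSchwinger r.ρ sch (fun s => s.F) k 1 (fun _ => r.curvature) ![f] *
                latticeSchwinger r.ρ sch (fun s => s.F) k 1 (fun _ => r.curvature) ![g] *
                latticeSchwinger r.ρ sch (fun s => s.F) k 1 (fun _ => r.curvature) ![h])|)) := by
  obtain ⟨G, _, _, _, _, hG, hHG⟩ := hH
  exact rpCoreDisjoint_false_of_lightFluxMode G hG (lightFluxMode_of_persistent G hHG)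

end Summit.QuantumFields.YangMills.Theorems.HypercubicLimit.Negative

end
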